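import Literature.Probability.RandomPlanarGeometry.UniformizingArcs
import Literature.Probability.RandomPlanarGeometry.RectangleModulusProofs
import Literature.Probability.RandomPlanarGeometry.PlanarDomainsTopology
import Literature.Probability.RandomPlanarGeometry.ChordalCurveFamily
import Literature.Barriers.CriticalPhenomena.EmbeddingModulusUniquenessProofs
import HarnessLib

/-!
# The comparison map of a sheared quadrilateral onto the Schwarz–Christoffel rectangle: boundary limits

Topic `Literature/Probability/RandomPlanarGeometry`; part of the variational proof of the named
fact `ShearCrossRatioAnalytic` (`ShearModulusAnalytic.lean`: the conformal modulus of Beffara's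
sheared quad `φ_α R'` is real-analytic in `α`). Everything is PROVED; no definition is introduced.

Data: a conformal rectangle `R'` with a uniformizing datum `(f, x')` (and a Carathéodory disc
extension `Φf`), a shear `φ_α = moduliShear α`, `im α > 0`, the sheared quad
`Q = R'.map (shearHomeomorph α _)` with a uniformizing datum `(F, y)` (disc extension `ΦF`), and
`0 < k < 1`. The **comparison map** is `Θ₀ = F_k ∘ F⁻¹ ∘ φ_α ∘ f : ℍₒ → (-K, K) × (0, K')`,
`F_k = scrFun k` the Schwarz–Christoffel rectangle map (`RectangleSCIntegrand.lean`,
`K = K(k²)`, `K' = K(1-k²)`). This file computes its boundary behaviour: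

* `tendsto_scrFun_symm_nhdsWithin` / `tendsto_scrFun_symm_apply_one` — `F_k ∘ F⁻¹` tends to
  `F_k(t)` at the boundary value `F(t)` of `F` at a real `t`, and to `iK'` at the boundary value
  at infinity (Carathéodory: `JordanDomain.tendsto_symm_nhds`, `tendsto_symm_cocompact`);
* `exists_tendsto_of_mem_uIcc`, `tendsto_or_exists_of_not_mem_uIoo`, `…_atInfty` — limits of
  `Θ₀` at real points and at infinity, located through the arc correspondence
  (`UniformizingArcs`): points between `x' i` and `x' (i+1)` go to `F_k` of points between
  `y i` and `y (i+1)`, the rest (and `∞`) to `F_k` of points outside `(y 0, y 3)` or to `iK'`;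
* `re_scrFunExt_of_mem_Icc_neg/pos`, `im_scrFunExt_of_mem_Icc`, `im_scrFunExt_of_le_abs` — the
  four closed sides of the rectangle as boundary values of `F_k`;
* `continuousOn_extendFrom` & co. — the continuous extension `Θ` of `Θ₀` to `{im ≥ 0}` and its
  values on the Dirichlet segments `[x' 0, x' 1]`, `[x' 2, x' 3]` (`re Θ = ∓ sK`) and elsewhere
  (`im Θ ∈ {0, K'}`), for a normalised datum `y = s · (-1/k, -1, 1, 1/k)`.

## References

* Ch. Pommerenke, *Boundary Behaviour of Conformal Maps* (1992), Thm. 2.6.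
* L. V. Ahlfors, *Lectures on Quasiconformal Mappings* (1966), Ch. I (modulus of a quadrilateral).
  [folklore]
-/

noncomputable section

open Set Filter Topology Complex Metric
open UpperHalfPlane (upperHalfPlaneSet isOpen_upperHalfPlaneSet)

namespace Literature.Probability.RandomPlanarGeometry

open Literature.Barriers.CriticalPhenomena (moduliShear shearHomeomorph coe_shearHomeomorph
  continuous_moduliShear)

namespace ShearComparison

/-! ### The four closed sides as boundary values of the Schwarz–Christoffel map -/

section Sides

variable {k : ℝ}

/-- The extension takes the value of any boundary limit (uniqueness of limits). [folklore] -/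
theorem scrFunExt_ofReal_eq (hk0 : 0 < k) (hk1 : k < 1) {t : ℝ} {L : ℂ}
    (h : Tendsto (scrFun k) (𝓝[upperHalfPlaneSet] (t : ℂ)) (𝓝 L)) : scrFunExt k t = L :=
  haveI := neBot_nhdsWithin_upperHalfPlaneSet t
  tendsto_nhds_unique (tendsto_scrFun_scrFunExt hk0 hk1 (by simp)) h

/-- **Left side**: for `t ∈ [-1/k, -1]`, `re F_k(t) = -K`. [folklore] -/
theorem re_scrFunExt_of_mem_Icc_neg (hk0 : 0 < k) (hk1 : k < 1) {t : ℝ}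
    (ht : t ∈ Icc (-k⁻¹) (-1 : ℝ)) : (scrFunExt k t).re = -ellipticK (k ^ 2) := by
  rcases ht.1.eq_or_lt with h1 | h1
  · rw [← h1, scrFunExt_ofReal_eq hk0 hk1 (tendsto_scrFun_neg_inv hk0 hk1)]
    simp
  rcases ht.2.lt_or_eq with h2 | h2
  · rw [scrFunExt_ofReal_eq hk0 hk1 (tendsto_scrFun_of_mem_Ioo_neg hk0 hk1 ⟨h1, h2⟩)]
    simp
  · rw [h2]
    have h := tendsto_scrFun_neg_one hk0 hk1
    rw [show (-1 : ℂ) = ((-1 : ℝ) : ℂ) by push_cast; ring] at h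
    rw [scrFunExt_ofReal_eq hk0 hk1 h]
    simp

/-- **Right side**: for `t ∈ [1, 1/k]`, `re F_k(t) = K`. [folklore] -/
theorem re_scrFunExt_of_mem_Icc_pos (hk0 : 0 < k) (hk1 : k < 1) {t : ℝ}
    (ht : t ∈ Icc (1 : ℝ) k⁻¹) : (scrFunExt k t).re = ellipticK (k ^ 2) := by
  rcases ht.1.eq_or_lt with h1 | h1
  · rw [← h1]
    have h := tendsto_scrFun_one hk0 hk1
    rw [show (1 : ℂ) = ((1 : ℝ) : ℂ) by push_cast; ring] at h
    rw [scrFunExt_ofReal_eq hk0 hk1 h]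
    simp
  rcases ht.2.lt_or_eq with h2 | h2
  · rw [scrFunExt_ofReal_eq hk0 hk1 (tendsto_scrFun_of_mem_Ioo_one_inv hk0 hk1 ⟨h1, h2⟩)]
    simp
  · rw [h2, scrFunExt_ofReal_eq hk0 hk1 (tendsto_scrFun_inv hk0 hk1)]
    simp

/-- **Bottom side**: for `t ∈ [-1, 1]`, `im F_k(t) = 0`. [folklore] -/
theorem im_scrFunExt_of_mem_Icc (hk0 : 0 < k) (hk1 : k < 1) {t : ℝ} (ht : t ∈ Icc (-1 : ℝ) 1) :
    (scrFunExt k t).im = 0 := by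
  rcases ht.1.eq_or_lt with h1 | h1
  · rw [← h1]
    have h := tendsto_scrFun_neg_one hk0 hk1
    rw [show (-1 : ℂ) = ((-1 : ℝ) : ℂ) by push_cast; ring] at h
    rw [scrFunExt_ofReal_eq hk0 hk1 h]
    simp
  rcases ht.2.lt_or_eq with h2 | h2
  · rw [scrFunExt_ofReal_eq hk0 hk1 (tendsto_scrFun_ofReal hk0.le hk1.le ⟨h1, h2⟩)]
    simp
  · rw [h2]
    have h := tendsto_scrFun_one hk0 hk1
    rw [show (1 : ℂ) = ((1 : ℝ) : ℂ) by push_cast; ring] at h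
    rw [scrFunExt_ofReal_eq hk0 hk1 h]
    simp

/-- **Top side**: for `|t| ≥ 1/k`, `im F_k(t) = K'`. [folklore] -/
theorem im_scrFunExt_of_le_abs (hk0 : 0 < k) (hk1 : k < 1) {t : ℝ} (ht : k⁻¹ ≤ |t|) :
    (scrFunExt k t).im = ellipticK (1 - k ^ 2) := by
  rcases ht.lt_or_eq with h | h
  · rw [scrFunExt_ofReal_eq hk0 hk1 (tendsto_scrFun_of_inv_lt_abs hk0 hk1 h)]
    simp
  · rcases le_or_gt 0 t with h0 | h0
    · rw [abs_of_nonneg h0] at h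
      rw [← h, scrFunExt_ofReal_eq hk0 hk1 (tendsto_scrFun_inv hk0 hk1)]
      simp
    · rw [abs_of_neg h0] at h
      rw [show t = -k⁻¹ by linarith, scrFunExt_ofReal_eq hk0 hk1 (tendsto_scrFun_neg_inv hk0 hk1)]
      simp

/-- The value at infinity `iK'` has `im = K'`. [folklore] -/
theorem im_I_mul_ellipticK (k : ℝ) : (I * (ellipticK (1 - k ^ 2) : ℂ)).im = ellipticK (1 - k ^ 2) := by
  simp

end Sides

/-! ### `F_k ∘ F⁻¹` at boundary points of a conformal rectangle -/

section Symm

variable {Q : ConformalRectangle} (F : ConformalEquiv upperHalfPlaneSet Q.carrier) {ΦF : ℂ → ℂ}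
  (hΦF : JordanDomain.IsDiscExtension Q.toJordanDomain F ΦF) {k : ℝ} (hk0 : 0 < k) (hk1 : k < 1)
include hΦF hk0 hk1

/-- At the boundary value `F(t)` of `F` at a real point `t`, `F_k ∘ F⁻¹ → F_k(t)` within `Q`.
[folklore] -/
theorem tendsto_scrFun_symm_nhdsWithin (t : ℝ) :
    Tendsto (fun w => scrFun k (F.symm w)) (𝓝[Q.carrier] (F.boundaryExtension t))
      (𝓝 (scrFunExt k t)) := by
  have hbv : F.HasBoundaryValue t (F.boundaryExtension t) := hΦF.tendsto_nhdsWithin (by simp)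
  have h1 : Tendsto F.symm (𝓝[Q.carrier] (F.boundaryExtension t)) (𝓝 (t : ℂ)) :=
    JordanDomain.tendsto_symm_nhds F hΦF.continuousOn hΦF.eqOn hΦF.bijOn.injOn hbv
  have h2 : Tendsto F.symm (𝓝[Q.carrier] (F.boundaryExtension t)) (𝓝[upperHalfPlaneSet] (t : ℂ)) :=
    tendsto_nhdsWithin_iff.2 ⟨h1, by
      filter_upwards [self_mem_nhdsWithin] with w hw
      exact F.symm_mapsTo hw⟩
  exact (tendsto_scrFun_scrFunExt hk0 hk1 (by simp)).comp h2

/-- At the boundary value `ΦF 1` of `F` at infinity, `F_k ∘ F⁻¹ → iK'` within `Q`. [folklore] -/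
theorem tendsto_scrFun_symm_apply_one :
    Tendsto (fun w => scrFun k (F.symm w)) (𝓝[Q.carrier] (ΦF 1))
      (𝓝 (I * (ellipticK (1 - k ^ 2) : ℂ))) := by
  have h1 : Tendsto F.symm (𝓝[Q.carrier] (ΦF 1)) (cocompact ℂ) :=
    JordanDomain.tendsto_symm_cocompact F hΦF.continuousOn hΦF.eqOn hΦF.bijOn.injOn
      hΦF.tendsto_cocompact
  have h2 : Tendsto F.symm (𝓝[Q.carrier] (ΦF 1)) (cocompact ℂ ⊓ 𝓟 upperHalfPlaneSet) :=
    tendsto_inf.2 ⟨h1, tendsto_principal.2 (by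
      filter_upwards [self_mem_nhdsWithin] with w hw
      exact F.symm_mapsTo hw)⟩
  exact (tendsto_scrFun_atInfty hk0 hk1).comp h2

end Symm

/-! ### The sheared quad and the map `φ_α ∘ f` at the boundary -/

section Shear

variable {R' : ConformalRectangle} {α : ℂ} (hα : 0 < α.im)

/-- Points of `φ_α(Ω')` are the `φ_α`-images of points of `Ω'`. [folklore] -/
theorem moduliShear_mem_carrier_map {v : ℂ} (hv : v ∈ R'.carrier) :
    moduliShear α v ∈ (R'.map (shearHomeomorph α hα.ne')).carrier := by
  rw [MarkedDomain.carrier_map, coe_shearHomeomorph]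
  exact mem_image_of_mem _ hv

/-- The arcs of `φ_α(Ω')` are the `φ_α`-images of the arcs of `Ω'`. [folklore] -/
theorem moduliShear_mem_arc_map {v : ℂ} {i : Fin 4} (hv : v ∈ R'.arc i) :
    moduliShear α v ∈ (R'.map (shearHomeomorph α hα.ne')).arc i := by
  rw [MarkedDomain.arc_map, coe_shearHomeomorph]
  exact mem_image_of_mem _ hv

variable (f : ConformalEquiv upperHalfPlaneSet R'.carrier) {Φf : ℂ → ℂ}
  (hΦf : JordanDomain.IsDiscExtension R'.toJordanDomain f Φf)
include hΦf

/-- `φ_α ∘ f` tends, within `ℍₒ` at a point of the closed half-plane, to `φ_α` of the boundary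
extension, within `φ_α(Ω')`. [folklore] -/
theorem tendsto_moduliShear_comp {z : ℂ} (hz : 0 ≤ z.im) :
    Tendsto (fun w => moduliShear α (f w)) (𝓝[upperHalfPlaneSet] z)
      (𝓝[(R'.map (shearHomeomorph α hα.ne')).carrier] (moduliShear α (f.boundaryExtension z))) := by
  refine tendsto_nhdsWithin_iff.2 ⟨?_, ?_⟩
  · exact ((continuous_moduliShear α).tendsto _).comp (hΦf.tendsto_nhdsWithin hz)
  · filter_upwards [self_mem_nhdsWithin] with w hw
    exact moduliShear_mem_carrier_map hα (f.mapsTo hw)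

/-- `φ_α ∘ f` tends at infinity within `ℍₒ` to `φ_α (Φf 1)`, within `φ_α(Ω')`. [folklore] -/
theorem tendsto_moduliShear_comp_atInfty :
    Tendsto (fun w => moduliShear α (f w)) (cocompact ℂ ⊓ 𝓟 upperHalfPlaneSet)
      (𝓝[(R'.map (shearHomeomorph α hα.ne')).carrier] (moduliShear α (Φf 1))) := by
  refine tendsto_nhdsWithin_iff.2 ⟨?_, ?_⟩
  · exact ((continuous_moduliShear α).tendsto _).comp hΦf.tendsto_cocompact
  · have : ∀ᶠ w in cocompact ℂ ⊓ 𝓟 upperHalfPlaneSet, w ∈ upperHalfPlaneSet :=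
      mem_inf_of_right (mem_principal_self _)
    filter_upwards [this] with w hw
    exact moduliShear_mem_carrier_map hα (f.mapsTo hw)

end Shear

/-! ### Limits of the comparison map `Θ₀ = F_k ∘ F⁻¹ ∘ φ_α ∘ f` -/

section Limits

variable {R' : ConformalRectangle} {α : ℂ} (hα : 0 < α.im)
  (f : ConformalEquiv upperHalfPlaneSet R'.carrier) {x' : Fin 4 → ℝ} {Φf : ℂ → ℂ}
  (hf : R'.IsUniformizing f x') (hΦf : JordanDomain.IsDiscExtension R'.toJordanDomain f Φf)
  (F : ConformalEquiv upperHalfPlaneSet (R'.map (shearHomeomorph α hα.ne')).carrier)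
  {y : Fin 4 → ℝ} {ΦF : ℂ → ℂ} (hF : (R'.map (shearHomeomorph α hα.ne')).IsUniformizing F y)
  (hΦF : JordanDomain.IsDiscExtension (R'.map (shearHomeomorph α hα.ne')).toJordanDomain F ΦF)
  {k : ℝ} (hk0 : 0 < k) (hk1 : k < 1)

include hΦf hΦF hk0 hk1

/-- **Limit on a Dirichlet/Neumann segment.** If `Ψ_f` maps `[a, b]` onto the arc `i` of `Ω'`
and `Ψ_F` maps `[a', b']` onto the arc `i` of `φ_α(Ω')`, then at every `x ∈ [a, b]` the
comparison map tends to `F_k(t)` for some `t ∈ [a', b']`. [folklore] -/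
theorem exists_tendsto_of_mem_uIcc {a b a' b' : ℝ} {i : Fin 4}
    (harcf : (fun t : ℝ => f.boundaryExtension t) '' uIcc a b = R'.arc i)
    (harcF : (fun t : ℝ => F.boundaryExtension t) '' uIcc a' b' =
      (R'.map (shearHomeomorph α hα.ne')).arc i)
    {x : ℝ} (hx : x ∈ uIcc a b) :
    ∃ t ∈ uIcc a' b', Tendsto (fun w => scrFun k (F.symm (moduliShear α (f w))))
      (𝓝[upperHalfPlaneSet] (x : ℂ)) (𝓝 (scrFunExt k t)) := by
  have hq : moduliShear α (f.boundaryExtension x) ∈ (R'.map (shearHomeomorph α hα.ne')).arc i := by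
    refine moduliShear_mem_arc_map hα ?_
    rw [← harcf]
    exact mem_image_of_mem _ hx
  rw [← harcF] at hq
  obtain ⟨t, ht, hteq⟩ := hq
  refine ⟨t, ht, ?_⟩
  have h1 := tendsto_moduliShear_comp hα f hΦf (z := (x : ℂ)) (by simp)
  rw [← hteq] at h1
  exact (tendsto_scrFun_symm_nhdsWithin F hΦF hk0 hk1 t).comp h1

include hf hF

/-- **Limit off the marked segments.** At a real `x` outside the open segment between `x' 0`
and `x' 3`, the comparison map tends to `iK'` or to `F_k(t)` for some `t` outside the open
segment between `y 0` and `y 3`. [folklore] -/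
theorem tendsto_or_exists_of_not_mem_uIoo {x : ℝ} (hx : x ∉ uIoo (x' 0) (x' 3)) :
    Tendsto (fun w => scrFun k (F.symm (moduliShear α (f w)))) (𝓝[upperHalfPlaneSet] (x : ℂ))
        (𝓝 (I * (ellipticK (1 - k ^ 2) : ℂ))) ∨
      ∃ t : ℝ, t ∉ uIoo (y 0) (y 3) ∧
        Tendsto (fun w => scrFun k (F.symm (moduliShear α (f w))))
          (𝓝[upperHalfPlaneSet] (x : ℂ)) (𝓝 (scrFunExt k t)) := by
  have hq : moduliShear α (f.boundaryExtension x) ∈ (R'.map (shearHomeomorph α hα.ne')).arc 3 :=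
    moduliShear_mem_arc_map hα (UniformizingArcs.mem_arc_three_of_not_mem_uIoo hΦf hf hx)
  have h1 := tendsto_moduliShear_comp hα f hΦf (z := (x : ℂ)) (by simp)
  rcases UniformizingArcs.eq_or_exists_of_mem_arc_three hΦF hF hq with heq | ⟨t, ht, hteq⟩
  · left
    rw [heq] at h1
    exact (tendsto_scrFun_symm_apply_one F hΦF hk0 hk1).comp h1
  · right
    refine ⟨t, ht, ?_⟩
    rw [← hteq] at h1
    exact (tendsto_scrFun_symm_nhdsWithin F hΦF hk0 hk1 t).comp h1

/-- **Limit at infinity.** At `∞` within `ℍₒ` the comparison map tends to `iK'` or to `F_k(t)`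
for some `t` outside the open segment between `y 0` and `y 3`. [folklore] -/
theorem tendsto_or_exists_atInfty :
    Tendsto (fun w => scrFun k (F.symm (moduliShear α (f w)))) (cocompact ℂ ⊓ 𝓟 upperHalfPlaneSet)
        (𝓝 (I * (ellipticK (1 - k ^ 2) : ℂ))) ∨
      ∃ t : ℝ, t ∉ uIoo (y 0) (y 3) ∧
        Tendsto (fun w => scrFun k (F.symm (moduliShear α (f w))))
          (cocompact ℂ ⊓ 𝓟 upperHalfPlaneSet) (𝓝 (scrFunExt k t)) := by
  have hq : moduliShear α (Φf 1) ∈ (R'.map (shearHomeomorph α hα.ne')).arc 3 :=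
    moduliShear_mem_arc_map hα (UniformizingArcs.apply_one_mem_arc_three hΦf hf)
  have h1 := tendsto_moduliShear_comp_atInfty hα f hΦf
  rcases UniformizingArcs.eq_or_exists_of_mem_arc_three hΦF hF hq with heq | ⟨t, ht, hteq⟩
  · left
    rw [heq] at h1
    exact (tendsto_scrFun_symm_apply_one F hΦF hk0 hk1).comp h1
  · right
    refine ⟨t, ht, ?_⟩
    rw [← hteq] at h1
    exact (tendsto_scrFun_symm_nhdsWithin F hΦF hk0 hk1 t).comp h1

omit hΦf hF hΦF hk0 hk1 in
/-- Segments cover: a real `x` lies in one of `[x' 0, x' 1]`, `[x' 1, x' 2]`, `[x' 2, x' 3]`, or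
outside the open segment between `x' 0` and `x' 3` (`x'` monotone). [folklore] -/
theorem mem_uIcc_cases (x : ℝ) :
    x ∈ uIcc (x' 0) (x' 1) ∨ x ∈ uIcc (x' 1) (x' 2) ∨ x ∈ uIcc (x' 2) (x' 3) ∨
      x ∉ uIoo (x' 0) (x' 3) := by
  have h01 : (0 : Fin 4) < 1 := by decide
  have h12 : (1 : Fin 4) < 2 := by decide
  have h23 : (2 : Fin 4) < 3 := by decide
  have h03 : (0 : Fin 4) < 3 := by decide
  rcases hf.1 with hm | hm
  · rw [uIcc_of_le (hm h01).le, uIcc_of_le (hm h12).le, uIcc_of_le (hm h23).le,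
      uIoo_of_le (hm h03).le]
    by_cases h0 : x ≤ x' 0
    · exact Or.inr (Or.inr (Or.inr fun h => not_lt.2 h0 h.1))
    by_cases h1 : x ≤ x' 1
    · exact Or.inl ⟨le_of_not_ge h0, h1⟩
    by_cases h2 : x ≤ x' 2
    · exact Or.inr (Or.inl ⟨le_of_not_ge h1, h2⟩)
    by_cases h3 : x ≤ x' 3
    · exact Or.inr (Or.inr (Or.inl ⟨le_of_not_ge h2, h3⟩))
    · exact Or.inr (Or.inr (Or.inr fun h => h3 h.2.le))
  · rw [uIcc_of_ge (hm h01).le, uIcc_of_ge (hm h12).le, uIcc_of_ge (hm h23).le,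
      uIoo_of_ge (hm h03).le]
    by_cases h0 : x' 0 ≤ x
    · exact Or.inr (Or.inr (Or.inr fun h => not_lt.2 h0 h.2))
    by_cases h1 : x' 1 ≤ x
    · exact Or.inl ⟨h1, le_of_not_ge h0⟩
    by_cases h2 : x' 2 ≤ x
    · exact Or.inr (Or.inl ⟨h2, le_of_not_ge h1⟩)
    by_cases h3 : x' 3 ≤ x
    · exact Or.inr (Or.inr (Or.inl ⟨h3, le_of_not_ge h2⟩))
    · exact Or.inr (Or.inr (Or.inr fun h => h3 h.1.le))

/-- **The comparison map has a limit within `ℍₒ` at every real point.** [folklore] -/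
theorem exists_tendsto_ofReal (x : ℝ) :
    ∃ L, Tendsto (fun w => scrFun k (F.symm (moduliShear α (f w)))) (𝓝[upperHalfPlaneSet] (x : ℂ))
      (𝓝 L) := by
  rcases mem_uIcc_cases f hf x with h | h | h | h
  · obtain ⟨t, -, ht⟩ := exists_tendsto_of_mem_uIcc hα f hΦf F hΦF hk0 hk1
      (UniformizingArcs.image_uIcc_eq_arc_zero hΦf hf) (UniformizingArcs.image_uIcc_eq_arc_zero hΦF hF) h
    exact ⟨_, ht⟩
  · obtain ⟨t, -, ht⟩ := exists_tendsto_of_mem_uIcc hα f hΦf F hΦF hk0 hk1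
      (UniformizingArcs.image_uIcc_eq_arc_one hΦf hf) (UniformizingArcs.image_uIcc_eq_arc_one hΦF hF) h
    exact ⟨_, ht⟩
  · obtain ⟨t, -, ht⟩ := exists_tendsto_of_mem_uIcc hα f hΦf F hΦF hk0 hk1
      (UniformizingArcs.image_uIcc_eq_arc_two hΦf hf) (UniformizingArcs.image_uIcc_eq_arc_two hΦF hF) h
    exact ⟨_, ht⟩
  · rcases tendsto_or_exists_of_not_mem_uIoo hα f hf hΦf F hF hΦF hk0 hk1 h with ht | ⟨t, -, ht⟩
    · exact ⟨_, ht⟩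
    · exact ⟨_, ht⟩

/-- **The comparison map has a limit within `ℍₒ` at every point of the closed half-plane.**
[folklore] -/
theorem exists_tendsto {z : ℂ} (hz : 0 ≤ z.im) :
    ∃ L, Tendsto (fun w => scrFun k (F.symm (moduliShear α (f w)))) (𝓝[upperHalfPlaneSet] z)
      (𝓝 L) := by
  rcases hz.lt_or_eq with hz | hz
  · -- interior point: continuity
    refine ⟨scrFun k (F.symm (moduliShear α (f z))), ?_⟩
    have h1 : ContinuousWithinAt (fun w => moduliShear α (f w)) upperHalfPlaneSet z :=
      ((continuous_moduliShear α).continuousAt).comp_continuousWithinAt (f.continuousOn z hz)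
    have h2 : ContinuousWithinAt F.symm (R'.map (shearHomeomorph α hα.ne')).carrier
        (moduliShear α (f z)) := F.symm.continuousOn _ (moduliShear_mem_carrier_map hα (f.mapsTo hz))
    have h3 : ContinuousWithinAt (scrFun k) upperHalfPlaneSet (F.symm (moduliShear α (f z))) :=
      (differentiableOn_scrFun_upperHalfPlaneSet hk0.le hk1.le).continuousOn _
        (F.symm_mapsTo (moduliShear_mem_carrier_map hα (f.mapsTo hz)))
    have h12 : ContinuousWithinAt (fun w => F.symm (moduliShear α (f w))) upperHalfPlaneSet z :=
      ContinuousWithinAt.comp (f := fun w => moduliShear α (f w)) (x := z) h2 h1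
        fun w hw => moduliShear_mem_carrier_map hα (f.mapsTo hw)
    exact (ContinuousWithinAt.comp (f := fun w => F.symm (moduliShear α (f w))) (x := z) h3 h12
      fun w hw => F.symm_mapsTo (moduliShear_mem_carrier_map hα (f.mapsTo hw))).tendsto
  · have hzre : ((z.re : ℝ) : ℂ) = z := Complex.ext (by simp) (by simp [← hz])
    rw [← hzre]
    exact exists_tendsto_ofReal hα f hf hΦf F hF hΦF hk0 hk1 z.re

/-- **The continuous extension `Θ` of the comparison map to the closed half-plane.**
[folklore] -/
theorem continuousOn_extendFrom :
    ContinuousOn (extendFrom upperHalfPlaneSet fun w => scrFun k (F.symm (moduliShear α (f w))))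
      {z : ℂ | 0 ≤ z.im} :=
  _root_.continuousOn_extendFrom (fun _ hz => mem_closure_upperHalfPlaneSet_iff.2 hz)
    fun _ hz => exists_tendsto hα f hf hΦf F hF hΦF hk0 hk1 hz

omit hf hF hΦf hΦF hk0 hk1 in
/-- On `ℍₒ` the extension is the comparison map itself. [folklore] -/
theorem extendFrom_apply_of_mem {z : ℂ} (hz : z ∈ upperHalfPlaneSet)
    (hk0 : 0 < k) (hk1 : k < 1) :
    extendFrom upperHalfPlaneSet (fun w => scrFun k (F.symm (moduliShear α (f w)))) z =
      scrFun k (F.symm (moduliShear α (f z))) := by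
  refine extendFrom_extends ?_ z hz
  intro w hw
  have h1 : ContinuousWithinAt (fun w => moduliShear α (f w)) upperHalfPlaneSet w :=
    ((continuous_moduliShear α).continuousAt).comp_continuousWithinAt (f.continuousOn w hw)
  have h2 : ContinuousWithinAt F.symm (R'.map (shearHomeomorph α hα.ne')).carrier
      (moduliShear α (f w)) := F.symm.continuousOn _ (moduliShear_mem_carrier_map hα (f.mapsTo hw))
  have h3 : ContinuousWithinAt (scrFun k) upperHalfPlaneSet (F.symm (moduliShear α (f w))) :=
    (differentiableOn_scrFun_upperHalfPlaneSet hk0.le hk1.le).continuousOn _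
      (F.symm_mapsTo (moduliShear_mem_carrier_map hα (f.mapsTo hw)))
  have h12 : ContinuousWithinAt (fun w => F.symm (moduliShear α (f w))) upperHalfPlaneSet w :=
    ContinuousWithinAt.comp (f := fun w => moduliShear α (f w)) (x := w) h2 h1
      fun v hv => moduliShear_mem_carrier_map hα (f.mapsTo hv)
  exact ContinuousWithinAt.comp (f := fun w => F.symm (moduliShear α (f w))) (x := w) h3 h12
    fun v hv => F.symm_mapsTo (moduliShear_mem_carrier_map hα (f.mapsTo hv))

omit hf hF hΦf hΦF hk0 hk1 in
/-- At a real point the extension is the limit. [folklore] -/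
theorem extendFrom_apply_ofReal {x : ℝ} {L : ℂ}
    (h : Tendsto (fun w => scrFun k (F.symm (moduliShear α (f w)))) (𝓝[upperHalfPlaneSet] (x : ℂ))
      (𝓝 L)) :
    extendFrom upperHalfPlaneSet (fun w => scrFun k (F.symm (moduliShear α (f w)))) x = L :=
  haveI := neBot_nhdsWithin_upperHalfPlaneSet x
  _root_.extendFrom_eq (mem_closure_upperHalfPlaneSet_iff.2 (by simp)) h

end Limits

/-! ### Values of the extension for a normalised datum `y = s · (-1/k, -1, 1, 1/k)` -/

section Normalised

variable {R' : ConformalRectangle} {α : ℂ} (hα : 0 < α.im)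
  (f : ConformalEquiv upperHalfPlaneSet R'.carrier) {x' : Fin 4 → ℝ} {Φf : ℂ → ℂ}
  (hf : R'.IsUniformizing f x') (hΦf : JordanDomain.IsDiscExtension R'.toJordanDomain f Φf)
  (F : ConformalEquiv upperHalfPlaneSet (R'.map (shearHomeomorph α hα.ne')).carrier)
  {ΦF : ℂ → ℂ} {k s : ℝ} (hk0 : 0 < k) (hk1 : k < 1) (hs : s = 1 ∨ s = -1)
  (hF : (R'.map (shearHomeomorph α hα.ne')).IsUniformizing F fun i => s * scrPrevertex k i)
  (hΦF : JordanDomain.IsDiscExtension (R'.map (shearHomeomorph α hα.ne')).toJordanDomain F ΦF)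

include hf hΦf hF hΦF hk0 hk1 hs

omit hf hΦf hF hΦF in
/-- The segment between `y 0` and `y 1` is `[-1/k, -1]` (`s = 1`) or `[1, 1/k]` (`s = -1`), and
on it `re F_k = -sK`. [folklore] -/
theorem re_scrFunExt_of_mem_uIcc01 {t : ℝ}
    (ht : t ∈ uIcc (s * scrPrevertex k 0) (s * scrPrevertex k 1)) :
    (scrFunExt k t).re = -(s * ellipticK (k ^ 2)) := by
  have e0 : scrPrevertex k 0 = -k⁻¹ := rfl
  have e1 : scrPrevertex k 1 = -1 := rfl
  have hk : (1 : ℝ) < k⁻¹ := one_lt_inv_iff₀.2 ⟨hk0, hk1⟩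
  rw [e0, e1] at ht
  rcases hs with rfl | rfl
  · rw [one_mul, one_mul, uIcc_of_le (by linarith)] at ht
    rw [re_scrFunExt_of_mem_Icc_neg hk0 hk1 ht, one_mul]
  · rw [uIcc_of_ge (by linarith)] at ht
    rw [re_scrFunExt_of_mem_Icc_pos hk0 hk1 ⟨by linarith [ht.1], by linarith [ht.2]⟩]
    ring

omit hf hΦf hF hΦF in
/-- The segment between `y 2` and `y 3`: `re F_k = sK` there. [folklore] -/
theorem re_scrFunExt_of_mem_uIcc23 {t : ℝ}
    (ht : t ∈ uIcc (s * scrPrevertex k 2) (s * scrPrevertex k 3)) :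
    (scrFunExt k t).re = s * ellipticK (k ^ 2) := by
  have e2 : scrPrevertex k 2 = 1 := rfl
  have e3 : scrPrevertex k 3 = k⁻¹ := rfl
  have hk : (1 : ℝ) < k⁻¹ := one_lt_inv_iff₀.2 ⟨hk0, hk1⟩
  rw [e2, e3] at ht
  rcases hs with rfl | rfl
  · rw [one_mul, one_mul, uIcc_of_le hk.le] at ht
    rw [re_scrFunExt_of_mem_Icc_pos hk0 hk1 ht, one_mul]
  · rw [uIcc_of_ge (by linarith)] at ht
    rw [re_scrFunExt_of_mem_Icc_neg hk0 hk1 ⟨by linarith [ht.1], by linarith [ht.2]⟩]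
    ring

omit hf hΦf hF hΦF in
/-- The segment between `y 1` and `y 2` is `[-1, 1]`: `im F_k = 0` there. [folklore] -/
theorem im_scrFunExt_of_mem_uIcc12 {t : ℝ}
    (ht : t ∈ uIcc (s * scrPrevertex k 1) (s * scrPrevertex k 2)) : (scrFunExt k t).im = 0 := by
  have e1 : scrPrevertex k 1 = -1 := rfl
  have e2 : scrPrevertex k 2 = 1 := rfl
  rw [e1, e2] at ht
  rcases hs with rfl | rfl
  · rw [one_mul, one_mul, uIcc_of_le (by norm_num)] at ht
    exact im_scrFunExt_of_mem_Icc hk0 hk1 ht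
  · rw [uIcc_of_ge (by norm_num)] at ht
    exact im_scrFunExt_of_mem_Icc hk0 hk1 ⟨by linarith [ht.1], by linarith [ht.2]⟩

omit hf hΦf hF hΦF in
/-- Outside the open segment between `y 0` and `y 3` (`= (-1/k, 1/k)`): `im F_k = K'`.
[folklore] -/
theorem im_scrFunExt_of_not_mem_uIoo03 {t : ℝ}
    (ht : t ∉ uIoo (s * scrPrevertex k 0) (s * scrPrevertex k 3)) :
    (scrFunExt k t).im = ellipticK (1 - k ^ 2) := by
  have e0 : scrPrevertex k 0 = -k⁻¹ := rfl
  have e3 : scrPrevertex k 3 = k⁻¹ := rfl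
  have hk : (0 : ℝ) < k⁻¹ := inv_pos.2 hk0
  rw [e0, e3] at ht
  have ht' : t ∉ Ioo (-k⁻¹) k⁻¹ := by
    rcases hs with rfl | rfl
    · rwa [one_mul, one_mul, uIoo_of_le (by linarith)] at ht
    · rwa [uIoo_of_ge (by linarith), show (-1 : ℝ) * k⁻¹ = -k⁻¹ by ring,
        show (-1 : ℝ) * -k⁻¹ = k⁻¹ by ring] at ht
  refine im_scrFunExt_of_le_abs hk0 hk1 ?_
  by_contra hlt
  exact ht' (abs_lt.1 (not_le.1 hlt))

/-- **Values on the first Dirichlet segment**: for real `x` between `x' 0` and `x' 1`,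
`re Θ(x) = -sK`. [folklore] -/
theorem re_extendFrom_of_mem_uIcc01 {x : ℝ} (hx : x ∈ uIcc (x' 0) (x' 1)) :
    (extendFrom upperHalfPlaneSet (fun w => scrFun k (F.symm (moduliShear α (f w)))) x).re =
      -(s * ellipticK (k ^ 2)) := by
  obtain ⟨t, ht, hlim⟩ := exists_tendsto_of_mem_uIcc hα f hΦf F hΦF hk0 hk1
    (UniformizingArcs.image_uIcc_eq_arc_zero hΦf hf) (UniformizingArcs.image_uIcc_eq_arc_zero hΦF hF) hx
  rw [extendFrom_apply_ofReal hα f F hlim]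
  exact re_scrFunExt_of_mem_uIcc01 hk0 hk1 hs ht

/-- **Values on the second Dirichlet segment**: for real `x` between `x' 2` and `x' 3`,
`re Θ(x) = sK`. [folklore] -/
theorem re_extendFrom_of_mem_uIcc23 {x : ℝ} (hx : x ∈ uIcc (x' 2) (x' 3)) :
    (extendFrom upperHalfPlaneSet (fun w => scrFun k (F.symm (moduliShear α (f w)))) x).re =
      s * ellipticK (k ^ 2) := by
  obtain ⟨t, ht, hlim⟩ := exists_tendsto_of_mem_uIcc hα f hΦf F hΦF hk0 hk1
    (UniformizingArcs.image_uIcc_eq_arc_two hΦf hf) (UniformizingArcs.image_uIcc_eq_arc_two hΦF hF) hx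
  rw [extendFrom_apply_ofReal hα f F hlim]
  exact re_scrFunExt_of_mem_uIcc23 hk0 hk1 hs ht

/-- **Values on the Neumann segment**: for real `x` between `x' 1` and `x' 2`, `im Θ(x) = 0`.
[folklore] -/
theorem im_extendFrom_of_mem_uIcc12 {x : ℝ} (hx : x ∈ uIcc (x' 1) (x' 2)) :
    (extendFrom upperHalfPlaneSet (fun w => scrFun k (F.symm (moduliShear α (f w)))) x).im = 0 := by
  obtain ⟨t, ht, hlim⟩ := exists_tendsto_of_mem_uIcc hα f hΦf F hΦF hk0 hk1
    (UniformizingArcs.image_uIcc_eq_arc_one hΦf hf) (UniformizingArcs.image_uIcc_eq_arc_one hΦF hF) hx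
  rw [extendFrom_apply_ofReal hα f F hlim]
  exact im_scrFunExt_of_mem_uIcc12 hk0 hk1 hs ht

/-- **Values off the marked segments**: for real `x` outside the open segment between `x' 0`
and `x' 3`, `im Θ(x) = K'`. [folklore] -/
theorem im_extendFrom_of_not_mem_uIoo03 {x : ℝ} (hx : x ∉ uIoo (x' 0) (x' 3)) :
    (extendFrom upperHalfPlaneSet (fun w => scrFun k (F.symm (moduliShear α (f w)))) x).im =
      ellipticK (1 - k ^ 2) := by
  rcases tendsto_or_exists_of_not_mem_uIoo hα f hf hΦf F hF hΦF hk0 hk1 hx with hlim | ⟨t, ht, hlim⟩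
  · rw [extendFrom_apply_ofReal hα f F hlim]
    simp
  · rw [extendFrom_apply_ofReal hα f F hlim]
    exact im_scrFunExt_of_not_mem_uIoo03 hk0 hk1 hs ht

/-- **Value at infinity**: the comparison map tends at `∞` within `ℍₒ` to a point with
`im = K'`. [folklore] -/
theorem exists_tendsto_atInfty :
    ∃ L : ℂ, L.im = ellipticK (1 - k ^ 2) ∧
      Tendsto (fun w => scrFun k (F.symm (moduliShear α (f w)))) (cocompact ℂ ⊓ 𝓟 upperHalfPlaneSet)
        (𝓝 L) := by
  rcases tendsto_or_exists_atInfty hα f hf hΦf F hF hΦF hk0 hk1 with hlim | ⟨t, ht, hlim⟩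
  · exact ⟨_, by simp, hlim⟩
  · exact ⟨_, im_scrFunExt_of_not_mem_uIoo03 hk0 hk1 hs ht, hlim⟩

/-- Trichotomy of the extension's boundary values: at a real `x`, either `x` is on the first
Dirichlet segment, or on the second, or `im Θ(x) ∈ {0, K'}`. [folklore] -/
theorem boundary_cases (x : ℝ) :
    x ∈ uIcc (x' 0) (x' 1) ∨ x ∈ uIcc (x' 2) (x' 3) ∨
      (extendFrom upperHalfPlaneSet (fun w => scrFun k (F.symm (moduliShear α (f w)))) x).im = 0 ∨
      (extendFrom upperHalfPlaneSet (fun w => scrFun k (F.symm (moduliShear α (f w)))) x).im =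
        ellipticK (1 - k ^ 2) := by
  rcases mem_uIcc_cases f hf x with h | h | h | h
  · exact Or.inl h
  · exact Or.inr (Or.inr (Or.inl (im_extendFrom_of_mem_uIcc12 hα f hf hΦf F hk0 hk1 hs hF hΦF h)))
  · exact Or.inr (Or.inl h)
  · exact Or.inr (Or.inr (Or.inr (im_extendFrom_of_not_mem_uIoo03 hα f hf hΦf F hk0 hk1 hs hF hΦF h)))

end Normalised

end ShearComparison

end Literature.Probability.RandomPlanarGeometry
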